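import Literature.AnabelianGeometry.EtaleTheta.Discharge.Sec2LampModelCompletion
import Mathlib.GroupTheory.Perm.Sign
import Mathlib.Algebra.GroupWithZero.Units.Fintype

/-!
# The lamplighter model of `ThetaCovers.TemperedCoverData` ([EtTh] §2), part 5 (DEF-BEARING): the tempered layer
# `Π^tp_Y`, `Π^tp_Ÿ`, `Π^tp_Ċ` and THE MODEL `lampModel l hl : TemperedCoverData l` (every odd `l`)

S. Mochizuki, *The étale theta function …*, Publ. RIMS **45** (2009) [MochizukiEtTh2009], §2, Def. 2.5 (PDF pp. 39–40): `Π^tp_C`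
densely in `Π_C`, the `Z`-covering `Y → X` («the natural quotient `Π^tp_X ↠ Z`»), `Ÿ` and the double covering `Ċ → C`
[cite: MochizukiEtTh2009, Def 2.5 p.39].  abc-iut cell, block F, seat abc-iut-f-142 (row F-0606, INSTANCE form).  The model's
remaining fields: `Π^tp_Y := heisPiX × Ker deg` (open, normal, NOT compact; `Π^tp_X/Π^tp_Y ≅ ℤ` by the degree, onto via `ζ^k`),
`Π^tp_Ÿ :=` the level-`0`-even-sign part (index `2`: the product of the signs of the level-`0` lamps is a rotation-invariant
character), `Π^tp_Ċ := A × Ker(deg mod 2)` (index `2`, `≠ Π^tp_X` as `(s, 1) ∈ Π^tp_Ċ`), and the assembled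
**`lampModel l hl : TemperedCoverData.{0} l`** (its `isProfiniteCompletion_toHat` is part 3, `Discharge/Sec2LampModelCompletion.lean`;
its cover data part 2).  Instance theorems: `Discharge/Sec2Lem217iiTrueAtLampModel.lean`.

HONEST FRAMING. A DESIGNED consistency witness for OUR typed interface (`G_K = 1`; lamplighter groups, not
fundamental groups of curves): it decides which typed sentences are CONSEQUENCES of the interface and which are not;
nothing of [EtTh] is asserted or denied for genuine tempered fundamental groups; instance-at-a-designed-carrier ≠ the
printed lemma; no side is taken on [IUTchIII] Cor. 3.12 or on any author; nothing here bears on abc. typed ≠ proved.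
-/

noncomputable section

namespace Literature.AnabelianGeometry.EtaleTheta

namespace ThetaCovers

namespace LampModel

section Part_4

open Multiplicative HeisenbergWitness Topology

variable (l : ℕ)

/-! ## 1. `Π^tp_Y := heisPiX × Ker(deg)` and `Π^tp_X / Π^tp_Y ≅ ℤ` -/

/-- `Ker(deg) ⊆ Q₀` is open (the degree is continuous). (toy bookkeeping) [cite: MochizukiEtTh2009, Def 2.5 p.39] -/
theorem isOpen_ker_deg : IsOpen (deg.ker : Set Qt) := by
  have : (deg.ker : Set Qt) = deg ⁻¹' {1} := by ext x; simp [MonoidHom.mem_ker]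
  rw [this]
  exact (isOpen_discrete _).preimage continuous_deg

/-- `Π^tp_Y := heisPiX × Ker(deg)` — "the kernel of the natural quotient `Π^tp_X ↠ Z`" of the model (`Z ≅ ℤ` via the
degree). (toy bookkeeping) [cite: MochizukiEtTh2009, Def 2.5 p.39] -/
def PiYtpL : Subgroup (Gtp l) := (AX l).prod deg.ker

/-- `Π^tp_Y` is normal in `Π^tp_C`. (toy bookkeeping) [cite: MochizukiEtTh2009, Def 2.5 p.39] -/
theorem PiYtpL_normal : (PiYtpL l).Normal := by
  haveI := AX_normal l
  haveI : (deg.ker : Subgroup Qt).Normal := MonoidHom.normal_ker _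
  exact Subgroup.prod_normal _ _

/-- `Π^tp_Y` is OPEN (and not compact). (toy bookkeeping) [cite: MochizukiEtTh2009, Def 2.5 p.39] -/
theorem isOpen_PiYtpL : IsOpen (PiYtpL l : Set (Gtp l)) :=
  (isOpen_discrete _).prod isOpen_ker_deg

/-- `Π^tp_Y ⊆ Π^tp_X`. (toy bookkeeping) [cite: MochizukiEtTh2009, Def 2.5 p.39] -/
theorem PiYtpL_le : PiYtpL l ≤ (PiXL l).comap (toHatL l) := by
  rw [comap_toHatL_PiXL]
  exact Subgroup.prod_mono le_rfl le_top

/-- **`Π^tp_X / Π^tp_Y ≅ ℤ`** via the degree (onto thanks to the rotations `ζ^k`). (toy bookkeeping)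
[cite: MochizukiEtTh2009, Def 2.5 p.39] -/
theorem nonempty_quotZ [(PiYtpL l).Normal] :
    Nonempty (↥((PiXL l).comap (toHatL l)) ⧸ ((PiYtpL l).subgroupOf ((PiXL l).comap (toHatL l))) ≃*
      Multiplicative ℤ) := by
  let K : Subgroup (Gtp l) := (PiXL l).comap (toHatL l)
  let f : ↥K →* Multiplicative ℤ := deg.comp ((MonoidHom.snd _ _).comp K.subtype)
  have hf : Function.Surjective f := fun n =>
    ⟨⟨((1 : A l), zetaHom n), by
      change _ ∈ (PiXL l).comap (toHatL l)
      rw [comap_toHatL_PiXL]; exact ⟨(AX l).one_mem, trivial⟩⟩, zetaHom_snd n⟩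
  have hker : f.ker = (PiYtpL l).subgroupOf K := by
    ext ⟨⟨a, x⟩, hax⟩
    rw [MonoidHom.mem_ker, Subgroup.mem_subgroupOf, PiYtpL, Subgroup.mem_prod, MonoidHom.mem_ker]
    have ha : a ∈ AX l := by
      have h : (a, x) ∈ (PiXL l).comap (toHatL l) := hax
      rw [comap_toHatL_PiXL] at h; exact h.1
    exact ⟨fun h => ⟨ha, h⟩, fun h => h.2⟩
  exact ⟨(QuotientGroup.quotientMulEquivOfEq hker.symm).trans
    (QuotientGroup.quotientKerEquivOfSurjective f hf)⟩

/-! ## 2. `Π^tp_Ÿ`: the level-`0` sign -/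

/-- The product of the signs of the lamps of a level (rotation invariant, hence a homomorphism on `W_n`). (toy bookkeeping)
[cite: MochizukiEtTh2009, Def 2.5 p.39] -/
def signProd (n : ℕ) : W n →* ℤˣ where
  toFun w := ∏ j, Equiv.Perm.sign (w.left j)
  map_one' := by simp
  map_mul' w w' := by
    simp only [SemidirectProduct.mul_left, Pi.mul_apply, map_mul, Finset.prod_mul_distrib, rot_apply]
    congr 1
    exact Fintype.prod_equiv (Equiv.subRight (toAdd w.right)) _ _ fun _ => rfl

/-- The level-`0` even-sign subgroup of `Q̂` (open, index `2`). (toy bookkeeping) [cite: MochizukiEtTh2009, Def 2.5 p.39] -/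
def sgn0 : Subgroup Qc := ((signProd 0).ker.comap (Pi.evalMonoidHom W 0)).comap Qhat.subtype

/-- Membership in `sgn0`. (toy bookkeeping) [cite: MochizukiEtTh2009, Def 2.5 p.39] -/
theorem mem_sgn0 {y : Qc} : y ∈ sgn0 ↔ signProd 0 ((y : Qfull) 0) = 1 := by
  rw [sgn0, Subgroup.mem_comap, Subgroup.mem_comap, MonoidHom.mem_ker]; rfl

/-- `sgn0` is open. (toy bookkeeping) [cite: MochizukiEtTh2009, Def 2.5 p.39] -/
theorem isOpen_sgn0 : IsOpen (sgn0 : Set Qc) := by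
  have : (sgn0 : Set Qc) = (fun y : Qc => (y : Qfull) 0) ⁻¹' {w | signProd 0 w = 1} := by
    ext y; exact mem_sgn0
  rw [this]
  exact (isOpen_discrete _).preimage ((continuous_apply 0).comp continuous_subtype_val)

/-- `Π^tp_Ÿ := heisPiX × (Ker(deg) ∩ ιQ⁻¹(sgn0))` — an open subgroup of index `2` of `Π^tp_Y` (the model's `Ÿ = Y₂`).
(toy bookkeeping) [cite: MochizukiEtTh2009, Def 2.5 p.40] -/
def PiYddtpL : Subgroup (Gtp l) := (AX l).prod (deg.ker ⊓ sgn0.comap ιQ)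

/-- `Π^tp_Ÿ` is open. (toy bookkeeping) [cite: MochizukiEtTh2009, Def 2.5 p.40] -/
theorem isOpen_PiYddtpL : IsOpen (PiYddtpL l : Set (Gtp l)) :=
  (isOpen_discrete _).prod (isOpen_ker_deg.inter (isOpen_sgn0.preimage continuous_ιQ))

/-- A degree-`0` element of `Q₀` of odd level-`0` sign: one transposition at level `0`, lamps off above. (toy bookkeeping)
[cite: MochizukiEtTh2009, Def 2.5 p.40] -/
def tOdd : Qt :=
  mkQt (fun n => if n = 0 then (fun _ => Equiv.swap (0 : Fin 3) 1) else 1) 0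
    (evCF_of_eventually_one (N := 1) fun n hn => by rw [if_neg (by omega)])

/-- Its level-`0` sign is `−1`. (toy bookkeeping) [cite: MochizukiEtTh2009, Def 2.5 p.40] -/
theorem signProd_tOdd : signProd 0 ((((tOdd : Qt) : Qc × Multiplicative ℤ).1 : Qfull) 0) = -1 := by
  change ∏ j : ZMod (Nl 0), Equiv.Perm.sign
    ((if (0 : ℕ) = 0 then (fun _ => Equiv.swap (0 : Fin 3) 1) else (1 : F 0)) j) = -1
  simp only [if_true, Finset.prod_const, Finset.card_univ, ZMod.card, Nl_zero, pow_one]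
  exact Equiv.Perm.sign_swap (by decide)

/-- **`[Π^tp_Y : Π^tp_Ÿ] = 2`** (the level-`0` sign is onto `{±1}` on `Π^tp_Y`). (toy bookkeeping)
[cite: MochizukiEtTh2009, Def 2.5 p.40] -/
theorem relIndex_PiYddtpL : (PiYddtpL l).relIndex (PiYtpL l) = 2 := by
  let χ : Qt →* ℤˣ := (signProd 0).comp ((Pi.evalMonoidHom W 0).comp (Qhat.subtype.comp ιQ))
  have hχ : ∀ x : Qt, χ x = 1 ↔ x ∈ sgn0.comap ιQ := fun x => by
    rw [Subgroup.mem_comap, mem_sgn0]; rfl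
  let g : ↥(PiYtpL l) →* ℤˣ := χ.comp ((MonoidHom.snd _ _).comp (PiYtpL l).subtype)
  have hg : Function.Surjective g := by
    intro u
    rcases Int.units_eq_one_or u with rfl | rfl
    · exact ⟨1, map_one _⟩
    · refine ⟨⟨((1 : A l), tOdd), ⟨(AX l).one_mem, rfl⟩⟩, ?_⟩
      exact signProd_tOdd
  have hker : g.ker = (PiYddtpL l).subgroupOf (PiYtpL l) := by
    ext ⟨⟨a, x⟩, hax⟩
    obtain ⟨ha, hx⟩ := Subgroup.mem_prod.mp hax
    rw [MonoidHom.mem_ker, Subgroup.mem_subgroupOf, PiYddtpL, Subgroup.mem_prod, Subgroup.mem_inf]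
    change χ x = 1 ↔ _
    rw [hχ]
    exact ⟨fun h => ⟨ha, hx, h⟩, fun h => h.2.2⟩
  change ((PiYddtpL l).subgroupOf (PiYtpL l)).index = 2
  rw [← hker, Subgroup.index_ker, MonoidHom.range_eq_top.mpr hg, Subgroup.card_top,
    Nat.card_eq_fintype_card, Fintype.card_units_int]

/-! ## 3. `Π^tp_Ċ`: the degree mod `2` -/

/-- The degree mod `2`. (toy bookkeeping) [cite: MochizukiEtTh2009, Def 2.5 p.39] -/
def deg2 : Qt →* Multiplicative (ZMod 2) := (Int.castAddHom (ZMod 2)).toMultiplicative.comp deg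

/-- Its kernel is open. (toy bookkeeping) [cite: MochizukiEtTh2009, Def 2.5 p.39] -/
theorem isOpen_ker_deg2 : IsOpen (deg2.ker : Set Qt) := by
  have : (deg2.ker : Set Qt) = deg ⁻¹' ((Int.castAddHom (ZMod 2)).toMultiplicative ⁻¹' {1}) := by
    ext x; simp [MonoidHom.mem_ker, deg2]
  rw [this]
  exact ((isOpen_discrete _).preimage continuous_of_discreteTopology).preimage continuous_deg

/-- `Π^tp_Ċ := A × Ker(deg mod 2)` — the model's double covering `Ċ → C`. (toy bookkeeping)
[cite: MochizukiEtTh2009, Def 2.5 p.39] -/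
def PiCdotL : Subgroup (Gtp l) := (⊤ : Subgroup (A l)).prod deg2.ker

/-- `[Π^tp_C : Π^tp_Ċ] = 2`. (toy bookkeeping) [cite: MochizukiEtTh2009, Def 2.5 p.39] -/
theorem index_PiCdotL : (PiCdotL l).index = 2 := by
  have hs : Function.Surjective deg2 := fun y => by
    obtain ⟨a, rfl⟩ := Multiplicative.ofAdd.surjective y
    obtain ⟨k, rfl⟩ := ZMod.intCast_surjective a
    refine ⟨zetaHom (Multiplicative.ofAdd k), ?_⟩
    have h1 : deg (zetaHom (ofAdd k)) = ofAdd k := zetaHom_snd _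
    change (Int.castAddHom (ZMod 2)).toMultiplicative (deg (zetaHom (ofAdd k))) = ofAdd (k : ZMod 2)
    rw [h1]
    rfl
  rw [PiCdotL, Subgroup.index_prod, Subgroup.index_top, one_mul, Subgroup.index_ker,
    MonoidHom.range_eq_top.mpr hs, Subgroup.card_top, Nat.card_eq_fintype_card, Fintype.card_multiplicative,
    ZMod.card]

/-- `Π^tp_Ċ` is open. (toy bookkeeping) [cite: MochizukiEtTh2009, Def 2.5 p.39] -/
theorem isOpen_PiCdotL : IsOpen (PiCdotL l : Set (Gtp l)) :=
  (isOpen_discrete _).prod isOpen_ker_deg2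

/-- `Ċ ≠ X` as coverings of `C` (`(s, 1) ∈ Π^tp_Ċ ∖ Π^tp_X`). (toy bookkeeping) [cite: MochizukiEtTh2009, Def 2.5 p.39] -/
theorem PiCdotL_ne : PiCdotL l ≠ (PiXL l).comap (toHatL l) := by
  rw [comap_toHatL_PiXL]
  intro h
  have hs : ((SemidirectProduct.inr (DihedralGroup.sr 0) : heisPiC l), (1 : Qt)) ∈ PiCdotL l :=
    ⟨trivial, (deg2 : Qt →* _).ker.one_mem⟩
  rw [h] at hs
  obtain ⟨i, hi⟩ := (mem_heisPiX l).mp ((mem_AX l).mp (Subgroup.mem_prod.mp hs).1)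
  cases hi

/-! ## 4. The model -/

variable [NeZero l]

/-- **THE LAMPLIGHTER MODEL** of `ThetaCovers.TemperedCoverData l` (every odd `l`): profinite layer = the Heisenberg
toy pulled back along `fst : heisPiC l × Q̂ → heisPiC l` (`coverDataAxL`, `Π_C̲̲ = PiCuuL`); tempered layer
`Π^tp_C := heisPiC l × Q₀ ↪ heisPiC l × Q̂ =: Π_C` with `Q₀ ⊆ Q̂ × ℤ` the position-wise eventually constant lamplighter
sequences of integer rotation, topologised so that the degree is continuous; `Π^tp_Y := heisPiX × Ker deg`,
`Π^tp_Ÿ :=` its level-`0`-even part, `Π^tp_Ċ := A × Ker(deg mod 2)`. DESIGNED CONSISTENCY WITNESS (`G_K = 1`) —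
NOT the tempered fundamental group of a curve; no claim about print. [cite: MochizukiEtTh2009, Def 2.5 p.39] -/
def lampModel (hl : Odd l) : TemperedCoverData.{0} l where
  toCoverDataAx := coverDataAxL l hl
  PiCuu := PiCuuL l
  isTypeLTorsThetaPm := isTypeLTorsThetaPm_PiCuuL l hl
  isOpen_PiCuu' := isOpen_PiCuuL l
  Gtp := Gtp l
  toHat := toHatL l
  continuous_toHat := continuous_toHatL l
  injective_toHat := toHatL_injective l
  isProfiniteCompletion_toHat := isProfiniteCompletion_toHatL l
  PiYtp := PiYtpL l
  PiYtp_le := PiYtpL_le l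
  PiYtp_normal := PiYtpL_normal l
  isOpen_PiYtp := isOpen_PiYtpL l
  quotZ := haveI := PiYtpL_normal l; nonempty_quotZ l
  PiYddtp := PiYddtpL l
  PiYddtp_le := Subgroup.prod_mono le_rfl inf_le_left
  isOpen_PiYddtp := isOpen_PiYddtpL l
  relIndex_PiYddtp := relIndex_PiYddtpL l
  PiCdot := PiCdotL l
  index_PiCdot := index_PiCdotL l
  isOpen_PiCdot := isOpen_PiCdotL l
  PiCdot_ne := PiCdotL_ne l

end Part_4

end LampModel

end ThetaCovers

end Literature.AnabelianGeometry.EtaleTheta
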